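import Summits.BirchSwinnertonDyer.BirchSwinnertonDyer.Theorems.Rank2Observatory2DescZ2SplitTwo
import HarnessLib

/-!
# BirchSwinnertonDyer — rank ≥ 2 observatory: the casework of the `μ_θ` descent at the split prime `2` (ℤ/2-torsion rows)

HONEST FRAMING: per-curve certified theorems and census instruments; no claim on BSD in rank ≥ 2.

Generic piece of the successor instrument KERNEL-2DESC-Z2 (spec
`code/b2b-bsdr2-cert-3/kernel-2desc-z2/README-Z2.md`, § "How the Lean casework should be organised"),
the `2`-adic twin of `…Z2OddCase`. Setting: `2` split in the quadratic order as two primes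
`d₁, d₂ : SplitTwo R` with residue maps to `ℤ/8` (`…Z2SplitTwo`), `θ² + Aθ + B = 0` with `A` ODD,
`res_i θ = t_i`, `ρ_i = res_i π_i'`. For a rational point in integral form (`x = n/e`, `e = d₀²`,
`2 ∤ gcd(n, d₀)`, `m² = n(n² + Ane + Be²)`, `α = n − eθ ≠ 0`, `n ≠ 0`) the pair of classes
`(bitsAt₂ d₁ α, bitsAt₂ d₂ α) ∈ ((ℤ/2)³)²` has one of two EXPLICIT shapes (`classes_point_cases₂`):

* `d₀` odd (`e ≡ 1 mod 8`), `n = 2^v n₀`: `(cls₂ A t₁ ρ₁ v̄ w r, cls₂ A t₂ ρ₂ v̄ w r)` with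
  `r = n₀ mod 8` odd, `w = 2^v mod 8`, `v̄ = v mod 2` constrained by `wcond v̄ w`; per prime the class
  is shallow `(0, bits8 (wr − t))` when `wr − t` is odd, else deep `(v̄, bits8 (ρ^{v̄} r (wr + A + t)))`
  (`pres_point_deep₂`, the conjugate-residue trick);
* `d₀` even (`n` odd, `e ≡ 0, 4 mod 8`): both shallow, `((0, bits8 (r − e₈t₁)), (0, bits8 (r − e₈t₂)))`.

All parameters range over `ℤ/8` and `ℤ/2`, so per row the inclusion of both shapes in an explicit
necessary set `N₂` is a `decide`. Sorry-free; axioms `propext`, `Classical.choice`, `Quot.sound`.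
[cite: Cassels1991LecturesEllipticCurves, §15]
-/

-- single-conjunct summit: `Summit.BirchSwinnertonDyer.BirchSwinnertonDyer.…` repeats the name by design
set_option linter.dupNamespace false

noncomputable section

namespace Summit.BirchSwinnertonDyer.BirchSwinnertonDyer.Rank2Observatory.TwoDescZ2

/-! ## `ℤ/8` bookkeeping -/

/-- In `ZMod 8`: if `a` is a unit and `x - t` is not, then `x + a + t` is a unit (by `decide`). [folklore] -/
theorem zmod8_conj_odd : ∀ x a t : ZMod 8, a ^ 2 = 1 → (x - t) ^ 2 ≠ 1 → (x + a + t) ^ 2 = 1 := by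
  decide

/-- `(2c)² ∈ {0, 4}` in `ZMod 8` (by `decide`). [folklore] -/
theorem zmod8_two_mul_sq : ∀ c : ZMod 8, (2 * c) ^ 2 = 0 ∨ (2 * c) ^ 2 = 4 := by decide

/-- In `ZMod 8`: `r` a unit and `e ∈ {0, 4}` give `r - e·t` a unit (by `decide`). [folklore] -/
theorem zmod8_shallow_evenDen : ∀ r e t : ZMod 8, r ^ 2 = 1 → (e = 0 ∨ e = 4) → (r - e * t) ^ 2 = 1 := by
  decide

/-- `d₀` even ⇒ `d₀² ≡ 0` or `4 (mod 8)`. [folklore] -/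
theorem zmod8_intCast_sq_even {d₀ : ℤ} (h : (2 : ℤ) ∣ d₀) :
    ((d₀ : ZMod 8)) ^ 2 = 0 ∨ ((d₀ : ZMod 8)) ^ 2 = 4 := by
  obtain ⟨c, rfl⟩ := h
  push_cast
  exact zmod8_two_mul_sq _

/-! ## The predicted classes -/

/-- Proxy for `ρ^v` (`ρ² = 1`): `1` if `v` is even, `ρ` if odd. -/
def rhoPow (ρ : ZMod 8) (vb : ZMod 2) : ZMod 8 := if vb = 0 then 1 else ρ

/-- For `ρ² = 1`, `ρ ^ v` depends only on `v mod 2`: `ρ ^ v = rhoPow ρ v`. [folklore] -/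
theorem pow_eq_rhoPow {ρ : ZMod 8} (hρ : ρ ^ 2 = 1) (v : ℕ) : ρ ^ v = rhoPow ρ (v : ZMod 2) := by
  rcases Nat.even_or_odd v with ⟨k, rfl⟩ | ⟨k, rfl⟩
  · rw [rhoPow, if_pos (ZMod.natCast_eq_zero_iff_even.mpr ⟨k, rfl⟩), ← two_mul, pow_mul, hρ, one_pow]
  · rw [rhoPow, if_neg (by rw [ZMod.natCast_eq_one_iff_odd.mpr ⟨k, rfl⟩]; decide), pow_succ, pow_mul, hρ,
      one_pow, one_mul]

/-- The admissible pairs `(v mod 2, 2^v mod 8)` (Boolean, kernel-computable). -/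
def wcond (vb : ZMod 2) (w : ZMod 8) : Bool :=
  (w == 1 && vb == 0) || (w == 2 && vb == 1) || (w == 4 && vb == 0) || w == 0

/-- The `2`-adic clause `wcond` holds on the pair `(v mod 2, 2 ^ v)`. [folklore] -/
theorem wcond_pow (v : ℕ) : wcond (v : ZMod 2) ((2 : ZMod 8) ^ v) = true := by
  match v with
  | 0 => decide
  | 1 => decide
  | 2 => decide
  | k + 3 =>
    rw [pow_add, show (2 : ZMod 8) ^ 3 = 0 from by decide, mul_zero]
    simp [wcond]

/-- Case `d₀` odd (`e ≡ 1 mod 8`, `n ≡ w·r`): shallow `(0, bits8 (wr − t))` if `wr − t` is odd, else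
deep `(v̄, bits8 (ρ^{v̄}·r·(wr + A + t)))`. [cite: Cassels1991LecturesEllipticCurves, §15] -/
def cls₂ (A : ℤ) (t ρ : ZMod 8) (vb : ZMod 2) (w r : ZMod 8) : ZMod 2 × ZMod 2 × ZMod 2 :=
  if (w * r - t) ^ 2 = 1 then ((0 : ZMod 2), bits8 (w * r - t))
  else (vb, bits8 (rhoPow ρ vb * r * (w * r + (A : ZMod 8) + t)))

/-! ## The casework -/

section Casework

variable {R : Type*} [CommRing R] [CharZero R] [IsDomain R] [WfDvdMonoid R]
variable {d : SplitTwo R} {θ : R} {A B : ℤ} {t₈ : ZMod 8}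

/-- One prime, `d₀` odd, `n = 2^v n₀` with `n₀` odd. [cite: Cassels1991LecturesEllipticCurves, §15] -/
theorem bitsAt₂_point_oddDen (hq : θ ^ 2 + (A : R) * θ + (B : R) = 0) (ht : d.res θ = t₈)
    (hA : ((A : ZMod 8)) ^ 2 = 1) {ρ : ZMod 8} (hρ : d.res d.π' = ρ)
    {n n₀ e m d₀ : ℤ} {v : ℕ} (hv : n = (2 : ℤ) ^ v * n₀) (hn₀ : ¬ (2 : ℤ) ∣ n₀)
    (he : e = d₀ ^ 2) (hd₀ : ¬ (2 : ℤ) ∣ d₀)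
    (hE : m ^ 2 = n * (n ^ 2 + A * n * e + B * e ^ 2)) (hα : (n : R) - (e : R) * θ ≠ 0) :
    bitsAt₂ d ((n : R) - (e : R) * θ) = cls₂ A t₈ ρ (v : ZMod 2) ((2 : ZMod 8) ^ v) (n₀ : ZMod 8) := by
  have he1 : (e : ZMod 8) = 1 := by rw [he]; push_cast; exact zmod8_intCast_sq_eq_one hd₀
  have hn8 : (n : ZMod 8) = (2 : ZMod 8) ^ v * (n₀ : ZMod 8) := by rw [hv]; push_cast; ring
  have hρ1 : ρ ^ 2 = 1 := by rw [← hρ]; exact d.hπ'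
  by_cases hsh : ((2 : ZMod 8) ^ v * (n₀ : ZMod 8) - t₈) ^ 2 = 1
  · -- shallow
    have hsh' : ((n : ZMod 8) - (e : ZMod 8) * t₈) ^ 2 = 1 := by rw [hn8, he1, one_mul]; exact hsh
    obtain ⟨h1, h2⟩ := pres_point_shallow₂ ht (n := n) (e := e) hsh'
    rw [bitsAt₂_eq h1 h2, res_point₂ ht, cls₂, if_pos hsh, hn8, he1, one_mul, Nat.cast_zero]
  · -- deep: the conjugate residue is odd
    have hodd : ((n : ZMod 8) + (e : ZMod 8) * (A : ZMod 8) + (e : ZMod 8) * t₈) ^ 2 = 1 := by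
      rw [hn8, he1, one_mul, one_mul]
      exact zmod8_conj_odd _ _ _ hA hsh
    obtain ⟨hp1, hp2, hp3⟩ := pres_intCast₂ (d := d) (R := R) hv hn₀
    obtain ⟨k', β', h1, h2, h3, h4⟩ :=
      pres_point_deep₂ hq ht hE hodd hα hp1 (by rw [hp2]; exact hp3)
    rw [bitsAt₂_eq h1 h2, cls₂, if_neg hsh, h3, h4, hp2, hρ, pow_eq_rhoPow hρ1, hn8, he1, one_mul,
      one_mul]

/-- One prime, `d₀` even (so `n` odd): shallow. [folklore] -/
theorem bitsAt₂_point_evenDen (ht : d.res θ = t₈) {n e d₀ : ℤ} (he : e = d₀ ^ 2)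
    (hd₀ : (2 : ℤ) ∣ d₀) (hn : ¬ (2 : ℤ) ∣ n) :
    bitsAt₂ d ((n : R) - (e : R) * θ) = (0, bits8 ((n : ZMod 8) - (e : ZMod 8) * t₈)) := by
  have he8 : (e : ZMod 8) = 0 ∨ (e : ZMod 8) = 4 := by
    rw [he]; push_cast; exact zmod8_intCast_sq_even hd₀
  have hsh : ((n : ZMod 8) - (e : ZMod 8) * t₈) ^ 2 = 1 :=
    zmod8_shallow_evenDen _ _ _ (zmod8_intCast_sq_eq_one hn) he8
  obtain ⟨h1, h2⟩ := pres_point_shallow₂ ht (n := n) (e := e) hsh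
  rw [bitsAt₂_eq h1 h2, res_point₂ ht, Nat.cast_zero]

variable {d₁ d₂ : SplitTwo R} {t₁ t₂ : ZMod 8}

/-- **The casework at the split prime `2`** (`A` odd). For a rational point in integral form with
`2 ∤ gcd(n, d₀)` and `n ≠ 0`, the pair of classes of `n − eθ` at the two primes over `2` has one of
two explicit shapes. [cite: Cassels1991LecturesEllipticCurves, §15] -/
theorem classes_point_cases₂ (hq : θ ^ 2 + (A : R) * θ + (B : R) = 0) (ht₁ : d₁.res θ = t₁)
    (ht₂ : d₂.res θ = t₂) (hA : ((A : ZMod 8)) ^ 2 = 1) {ρ₁ ρ₂ : ZMod 8}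
    (hρ₁ : d₁.res d₁.π' = ρ₁) (hρ₂ : d₂.res d₂.π' = ρ₂)
    {n e m d₀ : ℤ} (hn0 : n ≠ 0) (he : e = d₀ ^ 2) (hcop : ¬ ((2 : ℤ) ∣ n ∧ (2 : ℤ) ∣ d₀))
    (hE : m ^ 2 = n * (n ^ 2 + A * n * e + B * e ^ 2)) (hα : (n : R) - (e : R) * θ ≠ 0) :
    (∃ (vb : ZMod 2) (w r : ZMod 8), wcond vb w = true ∧ r ^ 2 = 1 ∧
        (bitsAt₂ d₁ ((n : R) - (e : R) * θ), bitsAt₂ d₂ ((n : R) - (e : R) * θ)) =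
          (cls₂ A t₁ ρ₁ vb w r, cls₂ A t₂ ρ₂ vb w r)) ∨
      (∃ r e₈ : ZMod 8, r ^ 2 = 1 ∧ (e₈ = 0 ∨ e₈ = 4) ∧
        (bitsAt₂ d₁ ((n : R) - (e : R) * θ), bitsAt₂ d₂ ((n : R) - (e : R) * θ)) =
          ((0, bits8 (r - e₈ * t₁)), (0, bits8 (r - e₈ * t₂)))) := by
  have h2p : Prime (2 : ℤ) := Int.prime_two
  by_cases hd₀ : (2 : ℤ) ∣ d₀
  · -- `d₀` even, `n` odd
    have hn : ¬ (2 : ℤ) ∣ n := fun h => hcop ⟨h, hd₀⟩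
    have he8 : (e : ZMod 8) = 0 ∨ (e : ZMod 8) = 4 := by
      rw [he]; push_cast; exact zmod8_intCast_sq_even hd₀
    refine Or.inr ⟨(n : ZMod 8), (e : ZMod 8), zmod8_intCast_sq_eq_one hn, he8, ?_⟩
    rw [bitsAt₂_point_evenDen ht₁ he hd₀ hn, bitsAt₂_point_evenDen ht₂ he hd₀ hn]
  · -- `d₀` odd
    obtain ⟨v, n₀, hn₀, hv⟩ := WfDvdMonoid.max_power_factor' hn0 h2p.not_unit
    refine Or.inl ⟨(v : ZMod 2), (2 : ZMod 8) ^ v, (n₀ : ZMod 8), wcond_pow v,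
      zmod8_intCast_sq_eq_one hn₀, ?_⟩
    rw [bitsAt₂_point_oddDen hq ht₁ hA hρ₁ hv hn₀ he hd₀ hE hα,
      bitsAt₂_point_oddDen hq ht₂ hA hρ₂ hv hn₀ he hd₀ hE hα]

end Casework

end Summit.BirchSwinnertonDyer.BirchSwinnertonDyer.Rank2Observatory.TwoDescZ2

end
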